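import Summits.ValiantsHypothesis.ValiantsHypothesis.Theorems.LacunarySymmetroidMatrixDescartesCensusDoorA34NullNullEndCells

/-!
# `MatrixDescartes` census — DOOR A at `(3,4)`: the PAIR TESTS of the null-null sheet at BOTH singular ends (isotropic-cone pair law of …SheetIsotropicCone applied
# with `P = S₃` and with `P = S₀` on a hypothetical null-null seventeen; orientation read on the bottom slot `c_{001} = tr(adj S₀·S₁)`)

HONEST FRAMING.  Object-search cell `pub-symmetroid`, engine seat `val-sym-eng-2` (g5); helper rows beside the registered strata line
`Cruxes/DoorA34/Lines/strata.lean` on stmt-ValiantsHypothesis-19980 (`DoorA34 = PosRootLawAt 3 4 18`: OPEN, typed, never asserted here); third stub `stub_nullNullCeiling`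
(`det S₀ = det S₃ = 0 ⇒ ≤ 16`).  On a null-null seventeen (sorted support) all `18` slot coefficients are non-zero with signs `(−1)^{ρ(e)}·sign c_{001}` (`ρ` = null-null
sheet rank, `c_{001}` the bottom slot); the pair law of the singular semidefinite letter (`sheet_pair_law_slots`) holds at the top end (`P = S₃`) AND at the bottom end
(`P = S₀`):

* `coeff_mixed_of_nullNull_seventeen` (dictionary row), `rank_subbottom_of_nullNull_seventeen` (`ρ(2d₀+d₁) = 0`);
* `nullNull_top_pair_relation` (`S₃ ⪰ 0`: `c_{3xx}, c_{3yy} > 0 ⇒ c_{33x}c_{33y}c_{3xy} > 0`, `x, y ∈ {0,1,2}`) / `_neg`; `nullNull_bottom_pair_relation` (`S₀ ⪰ 0`: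
  `c_{0xx}, c_{0yy} > 0 ⇒ c_{00x}c_{00y}c_{0xy} > 0`, `x, y ∈ {1,2,3}`) / `_neg`;
* **`card_posRoots_le_16_of_nullNull_topPairTest`**, **`card_posRoots_le_16_of_nullNull_bottomPairTest`** — decidable chamber tests (parities of `ρ`, orientation on `c_{001}`
  against the cell of the end letter) ⇒ `Z₊ ≤ 16`.

LOCATED context (seat atlas of the null-null sheet, report HOME/DOOR-A34-ENG2G5-REPORT.md §4).  Nothing here bounds anything else; `DoorA34` and the three stubs stay OPEN;
registers unchanged; nothing on `MatrixDescartes` (stmt-ValiantsHypothesis-18050) or `VP ≠ VNP` — VP≠VNP not moved.  [folklore] Descartes bookkeeping; elementary.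
-/

-- `Summit.ValiantsHypothesis.ValiantsHypothesis.…` repeats a component by the D-0017 layout
-- (single-conjunct summit), which the `dupNamespace` linter flags; the name is mandated.
set_option linter.dupNamespace false

namespace Summit.ValiantsHypothesis.ValiantsHypothesis.Theorems.LacunarySymmetroidMatrixDescartes.Census

open Polynomial Finset Matrix
open scoped BigOperators Polynomial Matrix

/-! ## 1. Dictionary and the bottom rank -/

/-- The MIXED slot `{i,j,k}` on a null-null seventeen (sorted support, pairwise distinct letters): coefficient and membership. [folklore] -/
theorem coeff_mixed_of_nullNull_seventeen (d : Fin 4 → ℕ) (hd : StrictMono d) (S : Fin 4 → Matrix (Fin 3) (Fin 3) ℝ) (h0 : (S 0).det = 0)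
    (h3 : (S 3).det = 0) (h17 : 17 ≤ ((Matrix.det (∑ l, ((X : ℝ[X]) ^ d l) • (S l).map C)).roots.toFinset.filter (fun t => 0 < t)).card) (i j k : Fin 4) (hij : i ≠ j) (hik : i ≠ k) (hjk : j ≠ k) :
    (Matrix.det (∑ l, ((X : ℝ[X]) ^ d l) • (S l).map C)).coeff (d i + d j + d k) = (((S i + S j).adjugate - (S i).adjugate - (S j).adjugate) * S k).trace ∧
    d i + d j + d k ∈ (Matrix.det (∑ l, ((X : ℝ[X]) ^ d l) • (S l).map C)).support := by
  have hcard : Multiset.card ({i, j, k} : Multiset (Fin 4)) = 3 := by simp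
  have hne : ∀ c : Fin 4, (⟨{i, j, k}, hcard⟩ : Sym (Fin 4) 3) ≠ Sym.replicate 3 c := fun c =>
    sym_mk_ne_replicate hcard c fun e => by
      have hi : i ∈ Multiset.replicate 3 c := by rw [← e]; simp
      have hj : j ∈ Multiset.replicate 3 c := by rw [← e]; simp
      exact hij ((Multiset.eq_of_mem_replicate hi).trans (Multiset.eq_of_mem_replicate hj).symm)
  have hσ : ((((⟨{i, j, k}, hcard⟩ : Sym (Fin 4) 3)) : Multiset (Fin 4)).map d).sum = d i + d j + d k := by
    simp only [Multiset.insert_eq_cons, Multiset.map_cons, Multiset.sum_cons, Multiset.map_singleton, Multiset.sum_singleton]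
    ring
  have huniq : ∀ f : Fin 3 → Fin 4, (∑ t, d (f t)) = d i + d j + d k →
      f = ![i, j, k] ∨ f = ![i, k, j] ∨ f = ![j, i, k] ∨ f = ![j, k, i] ∨ f = ![k, i, j] ∨ f = ![k, j, i] := by
    intro f hf
    have h := sym_eq_of_sum_eq_of_nullNull_seventeen d hd S h0 h3 h17 _ (hne 3) (hne 0) f (hf.trans hσ.symm)
    have hval : (Finset.univ.val.map f : Multiset (Fin 4)) = {i, j, k} := by
      have := congrArg (fun u : Sym (Fin 4) 3 => (u : Multiset (Fin 4))) h
      simpa using this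
    exact fun_eq_of_map_univ_eq_triple i j k hij hik hjk f hval
  refine ⟨coeff_det_pencil_three_mixed d S hij hik hjk huniq, ?_⟩
  rw [support_det_pencil_eq_of_nullNull_seventeen d S h0 h3 h17]
  exact Finset.mem_image.mpr ⟨_, Finset.mem_erase.mpr ⟨hne 0, Finset.mem_erase.mpr ⟨hne 3, Finset.mem_univ _⟩⟩, hσ⟩

/-- **`ρ(2d₀ + d₁) = 0`** on a null-null seventeen: the bottom slot `{0,0,1}` carries the smallest exponent. [folklore] -/
theorem rank_subbottom_of_nullNull_seventeen (d : Fin 4 → ℕ) (hd : StrictMono d) (S : Fin 4 → Matrix (Fin 3) (Fin 3) ℝ) (h0 : (S 0).det = 0)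
    (h3 : (S 3).det = 0) (h17 : 17 ≤ ((Matrix.det (∑ l, ((X : ℝ[X]) ^ d l) • (S l).map C)).roots.toFinset.filter (fun t => 0 < t)).card) : ((Matrix.det (∑ l, ((X : ℝ[X]) ^ d l) • (S l).map C)).support.filter (· < 2 * d 0 + d 1)).card = 0 := by
  rw [Finset.card_eq_zero, Finset.filter_eq_empty_iff]
  intro c hc
  rw [support_det_pencil_eq_of_nullNull_seventeen d S h0 h3 h17] at hc
  obtain ⟨s, hs, rfl⟩ := Finset.mem_image.mp hc
  have hs0 : s ≠ Sym.replicate 3 0 := (Finset.mem_erase.mp hs).1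
  by_cases h001 : (s : Multiset (Fin 4)) = {0, 0, 1}
  · have : ((s : Multiset (Fin 4)).map d).sum = 2 * d 0 + d 1 := by
      rw [h001]; simp only [Multiset.insert_eq_cons, Multiset.map_cons, Multiset.sum_cons, Multiset.map_singleton, Multiset.sum_singleton]; ring
    omega
  · exact not_lt.mpr (subbottom_lt_sym_sum_of_strictMono d hd s hs0 h001).le

/-! ## 2. Pair relations at the two singular ends -/

/-- **TOP-END PAIR RELATION (`S₃ ⪰ 0`)** on a null-null seventeen: lower letters `x, y ≠ 3` with `c_{3xx}, c_{3yy} > 0` ⇒ `c_{33x}·c_{33y}·c_{3xy} > 0`. [folklore] -/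
theorem nullNull_top_pair_relation (d : Fin 4 → ℕ) (hd : StrictMono d) (S : Fin 4 → Matrix (Fin 3) (Fin 3) ℝ) (hS : ∀ l, (S l).IsSymm)
    (h0 : (S 0).det = 0) (h3 : (S 3).det = 0) (hpsd : (S 3).PosSemidef) (h17 : 17 ≤ ((Matrix.det (∑ l, ((X : ℝ[X]) ^ d l) • (S l).map C)).roots.toFinset.filter (fun t => 0 < t)).card)
    {x y : Fin 4} (hx : x ≠ 3) (hqx : 0 < ((S x).adjugate * S 3).trace) (hqy : 0 < ((S y).adjugate * S 3).trace) :
    0 < ((S 3).adjugate * S x).trace * ((S 3).adjugate * S y).trace * (((S x + S y).adjugate - (S x).adjugate - (S y).adjugate) * S 3).trace :=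
  sheet_pair_law_slots hpsd h3 (hS x) (hS y) hqx hqy (trace_adjugate_mul_ne_zero_of_nullNull_seventeen d hd S h0 h3 h17 3 x hx.symm)

/-- Top end, `S₃ ⪯ 0`: `c_{3xx}, c_{3yy} < 0 ⇒ c_{33x}·c_{33y}·c_{3xy} < 0`. [folklore] -/
theorem nullNull_top_pair_relation_neg (d : Fin 4 → ℕ) (hd : StrictMono d) (S : Fin 4 → Matrix (Fin 3) (Fin 3) ℝ) (hS : ∀ l, (S l).IsSymm)
    (h0 : (S 0).det = 0) (h3 : (S 3).det = 0) (hnsd : (-(S 3)).PosSemidef) (h17 : 17 ≤ ((Matrix.det (∑ l, ((X : ℝ[X]) ^ d l) • (S l).map C)).roots.toFinset.filter (fun t => 0 < t)).card)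
    {x y : Fin 4} (hx : x ≠ 3) (hqx : ((S x).adjugate * S 3).trace < 0) (hqy : ((S y).adjugate * S 3).trace < 0) :
    ((S 3).adjugate * S x).trace * ((S 3).adjugate * S y).trace * (((S x + S y).adjugate - (S x).adjugate - (S y).adjugate) * S 3).trace < 0 :=
  sheet_pair_law_slots_neg hnsd h3 (hS x) (hS y) hqx hqy (trace_adjugate_mul_ne_zero_of_nullNull_seventeen d hd S h0 h3 h17 3 x hx.symm)

/-- **BOTTOM-END PAIR RELATION (`S₀ ⪰ 0`)**: upper letters `x, y ≠ 0` with `c_{0xx}, c_{0yy} > 0` ⇒ `c_{00x}·c_{00y}·c_{0xy} > 0`. [folklore] -/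
theorem nullNull_bottom_pair_relation (d : Fin 4 → ℕ) (hd : StrictMono d) (S : Fin 4 → Matrix (Fin 3) (Fin 3) ℝ) (hS : ∀ l, (S l).IsSymm)
    (h0 : (S 0).det = 0) (h3 : (S 3).det = 0) (hpsd : (S 0).PosSemidef) (h17 : 17 ≤ ((Matrix.det (∑ l, ((X : ℝ[X]) ^ d l) • (S l).map C)).roots.toFinset.filter (fun t => 0 < t)).card)
    {x y : Fin 4} (hx : x ≠ 0) (hqx : 0 < ((S x).adjugate * S 0).trace) (hqy : 0 < ((S y).adjugate * S 0).trace) :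
    0 < ((S 0).adjugate * S x).trace * ((S 0).adjugate * S y).trace * (((S x + S y).adjugate - (S x).adjugate - (S y).adjugate) * S 0).trace :=
  sheet_pair_law_slots hpsd h0 (hS x) (hS y) hqx hqy (trace_adjugate_mul_ne_zero_of_nullNull_seventeen d hd S h0 h3 h17 0 x hx.symm)

/-- Bottom end, `S₀ ⪯ 0`. [folklore] -/
theorem nullNull_bottom_pair_relation_neg (d : Fin 4 → ℕ) (hd : StrictMono d) (S : Fin 4 → Matrix (Fin 3) (Fin 3) ℝ) (hS : ∀ l, (S l).IsSymm)
    (h0 : (S 0).det = 0) (h3 : (S 3).det = 0) (hnsd : (-(S 0)).PosSemidef) (h17 : 17 ≤ ((Matrix.det (∑ l, ((X : ℝ[X]) ^ d l) • (S l).map C)).roots.toFinset.filter (fun t => 0 < t)).card)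
    {x y : Fin 4} (hx : x ≠ 0) (hqx : ((S x).adjugate * S 0).trace < 0) (hqy : ((S y).adjugate * S 0).trace < 0) :
    ((S 0).adjugate * S x).trace * ((S 0).adjugate * S y).trace * (((S x + S y).adjugate - (S x).adjugate - (S y).adjugate) * S 0).trace < 0 :=
  sheet_pair_law_slots_neg hnsd h0 (hS x) (hS y) hqx hqy (trace_adjugate_mul_ne_zero_of_nullNull_seventeen d hd S h0 h3 h17 0 x hx.symm)

/-! ## 3. The two pair tests (decidable in `d`; orientation on the bottom slot `c_{001}`) -/

/-- **TOP-END PAIR TEST on the null-null sheet.**  `e ∈ {0,3}`-free formulation with `P = S₃`: lower letters `x ≠ y` (both `≠ 3`) with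
`ρ(2d_x+d₃) ≡ ρ(2d_y+d₃)` and `ρ(d_x+d_y+d₃)+ρ(2d₃+d_x)+ρ(2d₃+d_y) ≢ ρ(2d_x+d₃)`; orientation: `S₃ ⪰ 0 ∧ (−1)^{ρ(2d_x+d₃)}·c_{001} > 0` or
`S₃ ⪯ 0 ∧ (−1)^{ρ(2d_x+d₃)}·c_{001} < 0` ⇒ `Z₊ ≤ 16`. [folklore] -/
theorem card_posRoots_le_16_of_nullNull_topPairTest (d : Fin 4 → ℕ) (hd : StrictMono d) (S : Fin 4 → Matrix (Fin 3) (Fin 3) ℝ)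
    (hS : ∀ l, (S l).IsSymm) (h0 : (S 0).det = 0) (h3 : (S 3).det = 0)
    (ρ : ℕ → ℕ) (hρ : ∀ n, ρ n = ((((((Finset.univ : Finset (Sym (Fin 4) 3)).erase (Sym.replicate 3 3)).erase (Sym.replicate 3 0)).image
          (fun s : Sym (Fin 4) 3 => ((s : Multiset (Fin 4)).map d).sum)).filter (· < n)).card))
    {x y : Fin 4} (hxy : x ≠ y) (hx : x ≠ 3) (hy : y ≠ 3)
    (hsq : ρ (2 * d x + d 3) % 2 = ρ (2 * d y + d 3) % 2)
    (hmix : (ρ (d x + d y + d 3) + ρ (2 * d 3 + d x) + ρ (2 * d 3 + d y)) % 2 ≠ ρ (2 * d x + d 3) % 2)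
    (hor : ((S 3).PosSemidef ∧ 0 < (-1 : ℝ) ^ ρ (2 * d x + d 3) * ((S 0).adjugate * S 1).trace)
      ∨ ((-(S 3)).PosSemidef ∧ (-1 : ℝ) ^ ρ (2 * d x + d 3) * ((S 0).adjugate * S 1).trace < 0)) :
    ((Matrix.det (∑ l, ((X : ℝ[X]) ^ d l) • (S l).map C)).roots.toFinset.filter (fun t => 0 < t)).card ≤ 16 := by
  by_contra hlt
  have h17 : 17 ≤ ((Matrix.det (∑ l, ((X : ℝ[X]) ^ d l) • (S l).map C)).roots.toFinset.filter (fun t => 0 < t)).card := by omega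
  have hρ' : ∀ n, ρ n = ((Matrix.det (∑ l, ((X : ℝ[X]) ^ d l) • (S l).map C)).support.filter (· < n)).card := fun n => by
    rw [hρ, sheetRank_eq_of_nullNull_seventeen d S h0 h3 h17]
  obtain ⟨cxx, mxx⟩ := coeff_square_of_nullNull_seventeen d hd S h0 h3 h17 x 3 hx
  obtain ⟨cyy, myy⟩ := coeff_square_of_nullNull_seventeen d hd S h0 h3 h17 y 3 hy
  obtain ⟨cTx, mTx⟩ := coeff_square_of_nullNull_seventeen d hd S h0 h3 h17 3 x hx.symm
  obtain ⟨cTy, mTy⟩ := coeff_square_of_nullNull_seventeen d hd S h0 h3 h17 3 y hy.symm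
  obtain ⟨cxy, mxy⟩ := coeff_mixed_of_nullNull_seventeen d hd S h0 h3 h17 x y 3 hxy hx hy
  obtain ⟨c01, m01⟩ := coeff_square_of_nullNull_seventeen d hd S h0 h3 h17 0 1 (by decide)
  have hrank0 := rank_subbottom_of_nullNull_seventeen d hd S h0 h3 h17
  have r1 := (coeff_mul_coeff_sign_of_nullNull_seventeen d S h0 h3 h17 mxx myy).1 (by rw [← hρ', ← hρ']; omega)
  rw [cxx, cyy] at r1
  have r2 := coeff_mul_coeff_sign_of_nullNull_seventeen d S h0 h3 h17 mxx mxy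
  have r3 := coeff_mul_coeff_sign_of_nullNull_seventeen d S h0 h3 h17 mTx mTy
  rw [cxx, cxy, ← hρ', ← hρ'] at r2
  rw [cTx, cTy, ← hρ', ← hρ'] at r3
  have neg : ((S x).adjugate * S 3).trace
      * (((S 3).adjugate * S x).trace * ((S 3).adjugate * S y).trace * (((S x + S y).adjugate - (S x).adjugate - (S y).adjugate) * S 3).trace) < 0 := by
    rcases Nat.mod_two_eq_zero_or_one (ρ (2 * d x + d 3) + ρ (d x + d y + d 3)) with p2 | p2 <;>
    rcases Nat.mod_two_eq_zero_or_one (ρ (2 * d 3 + d x) + ρ (2 * d 3 + d y)) with p3 | p3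
    · exfalso; omega
    · nlinarith [r2.1 p2, r3.2 p3]
    · nlinarith [r2.2 p2, r3.1 p3]
    · exfalso; omega
  have r0 := coeff_mul_coeff_sign_of_nullNull_seventeen d S h0 h3 h17 m01 mxx
  rw [c01, cxx, hrank0, zero_add, ← hρ'] at r0
  rcases hor with ⟨hpsd, w⟩ | ⟨hnsd, w⟩
  · have hxx : 0 < ((S x).adjugate * S 3).trace := by
      rcases Nat.mod_two_eq_zero_or_one (ρ (2 * d x + d 3)) with p | p
      · have := r0.1 p
        rw [neg_one_pow_eq_pow_mod_two, p, pow_zero, one_mul] at w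
        nlinarith [this, w]
      · have := r0.2 p
        rw [neg_one_pow_eq_pow_mod_two, p, pow_one, neg_one_mul, neg_pos] at w
        nlinarith [this, w]
    have hyy : 0 < ((S y).adjugate * S 3).trace := by nlinarith [r1, hxx]
    have law := nullNull_top_pair_relation d hd S hS h0 h3 hpsd h17 hx hxx hyy
    nlinarith [mul_pos hxx law]
  · have hxx : ((S x).adjugate * S 3).trace < 0 := by
      rcases Nat.mod_two_eq_zero_or_one (ρ (2 * d x + d 3)) with p | p
      · have := r0.1 p
        rw [neg_one_pow_eq_pow_mod_two, p, pow_zero, one_mul] at w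
        nlinarith [this, w]
      · have := r0.2 p
        rw [neg_one_pow_eq_pow_mod_two, p, pow_one, neg_one_mul, neg_lt_zero] at w
        nlinarith [this, w]
    have hyy : ((S y).adjugate * S 3).trace < 0 := by nlinarith [r1, hxx]
    have law := nullNull_top_pair_relation_neg d hd S hS h0 h3 hnsd h17 hx hxx hyy
    nlinarith [mul_pos_of_neg_of_neg hxx law]

/-- **BOTTOM-END PAIR TEST on the null-null sheet** (`P = S₀`): upper letters `x ≠ y` (both `≠ 0`) with `ρ(2d_x+d₀) ≡ ρ(2d_y+d₀)` and
`ρ(d_x+d_y+d₀)+ρ(2d₀+d_x)+ρ(2d₀+d_y) ≢ ρ(2d_x+d₀)`; orientation: `S₀ ⪰ 0 ∧ (−1)^{ρ(2d_x+d₀)}·c_{001} > 0` or `S₀ ⪯ 0 ∧ … < 0` ⇒ `Z₊ ≤ 16`. [folklore] -/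
theorem card_posRoots_le_16_of_nullNull_bottomPairTest (d : Fin 4 → ℕ) (hd : StrictMono d) (S : Fin 4 → Matrix (Fin 3) (Fin 3) ℝ)
    (hS : ∀ l, (S l).IsSymm) (h0 : (S 0).det = 0) (h3 : (S 3).det = 0)
    (ρ : ℕ → ℕ) (hρ : ∀ n, ρ n = ((((((Finset.univ : Finset (Sym (Fin 4) 3)).erase (Sym.replicate 3 3)).erase (Sym.replicate 3 0)).image
          (fun s : Sym (Fin 4) 3 => ((s : Multiset (Fin 4)).map d).sum)).filter (· < n)).card))
    {x y : Fin 4} (hxy : x ≠ y) (hx : x ≠ 0) (hy : y ≠ 0)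
    (hsq : ρ (2 * d x + d 0) % 2 = ρ (2 * d y + d 0) % 2)
    (hmix : (ρ (d x + d y + d 0) + ρ (2 * d 0 + d x) + ρ (2 * d 0 + d y)) % 2 ≠ ρ (2 * d x + d 0) % 2)
    (hor : ((S 0).PosSemidef ∧ 0 < (-1 : ℝ) ^ ρ (2 * d x + d 0) * ((S 0).adjugate * S 1).trace)
      ∨ ((-(S 0)).PosSemidef ∧ (-1 : ℝ) ^ ρ (2 * d x + d 0) * ((S 0).adjugate * S 1).trace < 0)) :
    ((Matrix.det (∑ l, ((X : ℝ[X]) ^ d l) • (S l).map C)).roots.toFinset.filter (fun t => 0 < t)).card ≤ 16 := by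
  by_contra hlt
  have h17 : 17 ≤ ((Matrix.det (∑ l, ((X : ℝ[X]) ^ d l) • (S l).map C)).roots.toFinset.filter (fun t => 0 < t)).card := by omega
  have hρ' : ∀ n, ρ n = ((Matrix.det (∑ l, ((X : ℝ[X]) ^ d l) • (S l).map C)).support.filter (· < n)).card := fun n => by
    rw [hρ, sheetRank_eq_of_nullNull_seventeen d S h0 h3 h17]
  obtain ⟨cxx, mxx⟩ := coeff_square_of_nullNull_seventeen d hd S h0 h3 h17 x 0 hx
  obtain ⟨cyy, myy⟩ := coeff_square_of_nullNull_seventeen d hd S h0 h3 h17 y 0 hy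
  obtain ⟨cTx, mTx⟩ := coeff_square_of_nullNull_seventeen d hd S h0 h3 h17 0 x hx.symm
  obtain ⟨cTy, mTy⟩ := coeff_square_of_nullNull_seventeen d hd S h0 h3 h17 0 y hy.symm
  obtain ⟨cxy, mxy⟩ := coeff_mixed_of_nullNull_seventeen d hd S h0 h3 h17 x y 0 hxy hx hy
  obtain ⟨c01, m01⟩ := coeff_square_of_nullNull_seventeen d hd S h0 h3 h17 0 1 (by decide)
  have hrank0 := rank_subbottom_of_nullNull_seventeen d hd S h0 h3 h17
  have r1 := (coeff_mul_coeff_sign_of_nullNull_seventeen d S h0 h3 h17 mxx myy).1 (by rw [← hρ', ← hρ']; omega)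
  rw [cxx, cyy] at r1
  have r2 := coeff_mul_coeff_sign_of_nullNull_seventeen d S h0 h3 h17 mxx mxy
  have r3 := coeff_mul_coeff_sign_of_nullNull_seventeen d S h0 h3 h17 mTx mTy
  rw [cxx, cxy, ← hρ', ← hρ'] at r2
  rw [cTx, cTy, ← hρ', ← hρ'] at r3
  have neg : ((S x).adjugate * S 0).trace
      * (((S 0).adjugate * S x).trace * ((S 0).adjugate * S y).trace * (((S x + S y).adjugate - (S x).adjugate - (S y).adjugate) * S 0).trace) < 0 := by
    rcases Nat.mod_two_eq_zero_or_one (ρ (2 * d x + d 0) + ρ (d x + d y + d 0)) with p2 | p2 <;>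
    rcases Nat.mod_two_eq_zero_or_one (ρ (2 * d 0 + d x) + ρ (2 * d 0 + d y)) with p3 | p3
    · exfalso; omega
    · nlinarith [r2.1 p2, r3.2 p3]
    · nlinarith [r2.2 p2, r3.1 p3]
    · exfalso; omega
  have r0 := coeff_mul_coeff_sign_of_nullNull_seventeen d S h0 h3 h17 m01 mxx
  rw [c01, cxx, hrank0, zero_add, ← hρ'] at r0
  rcases hor with ⟨hpsd, w⟩ | ⟨hnsd, w⟩
  · have hxx : 0 < ((S x).adjugate * S 0).trace := by
      rcases Nat.mod_two_eq_zero_or_one (ρ (2 * d x + d 0)) with p | p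
      · have := r0.1 p
        rw [neg_one_pow_eq_pow_mod_two, p, pow_zero, one_mul] at w
        nlinarith [this, w]
      · have := r0.2 p
        rw [neg_one_pow_eq_pow_mod_two, p, pow_one, neg_one_mul, neg_pos] at w
        nlinarith [this, w]
    have hyy : 0 < ((S y).adjugate * S 0).trace := by nlinarith [r1, hxx]
    have law := nullNull_bottom_pair_relation d hd S hS h0 h3 hpsd h17 hx hxx hyy
    nlinarith [mul_pos hxx law]
  · have hxx : ((S x).adjugate * S 0).trace < 0 := by
      rcases Nat.mod_two_eq_zero_or_one (ρ (2 * d x + d 0)) with p | p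
      · have := r0.1 p
        rw [neg_one_pow_eq_pow_mod_two, p, pow_zero, one_mul] at w
        nlinarith [this, w]
      · have := r0.2 p
        rw [neg_one_pow_eq_pow_mod_two, p, pow_one, neg_one_mul, neg_lt_zero] at w
        nlinarith [this, w]
    have hyy : ((S y).adjugate * S 0).trace < 0 := by nlinarith [r1, hxx]
    have law := nullNull_bottom_pair_relation_neg d hd S hS h0 h3 hnsd h17 hx hxx hyy
    nlinarith [mul_pos_of_neg_of_neg hxx law]

end Summit.ValiantsHypothesis.ValiantsHypothesis.Theorems.LacunarySymmetroidMatrixDescartes.Census
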